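import Summits.QuantumFields.YangMills.Theorems.BalabanUVNodesN15KingModelCovariantBlockRoughWitness
import Summits.QuantumFields.YangMills.Theorems.BalabanUVNodesN15KingModelCovariantRandomWalk
import HarnessLib

/-!
# BalabanUVNodes ∕ N15 — THE KING-MODEL RUNG (PART Ϥ-m): THE BLOCK AXIAL GAUGE AND THE LATTICE POINCARÉ LEMMA — in the gauge `g(x) = U(Γ_{y,x})` (transport to the block corner along the
# comb) every contour bond is `1`, and SMALL CURVATURE ON THE BLOCK MAKES EVERY INTRA-BLOCK BOND SMALL: if `‖P_U(x;μ,ν) − 1‖ ≤ ε` for the plaquettes based in the block, then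
# `‖U^{ax}(b) − 1‖ ≤ (Σ_{ν>μ} j_ν)·ε ≤ d(L−1)ε` for the intra-block bond `b` into the offset `j` along `μ` — by DETERMINATION DOWN THE COMB (the attached plaquette of a non-comb bond has
# two comb sides; [Federbush1987PhaseCellIII] §5.3 «Observation», tree `Federbush1986.CombGaugeObservation` on `ℤ^d` boxes), quantitatively, for every fibre and every group
# (Track A, DAG node N15 = NE2; FAN-OUT v1.1 §N15 s3 «KING-MODEL RUNG … + what the curved case adds»; count-neutral)

HONEST FRAMING.  Count-neutral (cell `pub-ymgap`, seat `pub-ymgap-dag-n15-e` g49; `--supports stmt-QuantumFields-27247 --as helper` = K3ᴬ, KEY MAP v3).  King's comparison model; the comb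
contours of PART Ϥ-b on one block of King's torus; the hypothesis is Bałaban's regularity in its curvature form ([Balaban1985BackgroundPropagators] (3.35) p.396: `|U(∂p) − 1| < ε`-type bound
on plaquette variables), the conclusion is the small-field form used by PART Ϥ-h ((3.37)-type) — ON INTRA-BLOCK BONDS ONLY (inter-block bonds in the block axial gauge carry coarse link
variables and are not small).  NOT a node discharge (N15 of record untouched); nothing continuum ∕ ℝ⁴ ∕ OS ∕ Clay.

THE MATHEMATICS.  `g(site y j) := U(Γ_{y,x_j})` (PART Ϥ-b `treeHol`, comb), `U^{ax} := U^g` (Ͱ-a `kingGaugeAct`): (i) `U^{ax}(x⁻, axis j) = 1` on the comb bond into `x_j` (`U(Γ_j) =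
U(Γ_{parent})U(x⁻,μ)`); (ii) for an intra-block bond into `x_j` along `μ` (`j_μ ≠ 0`) that is NOT a comb bond, let `ν* > μ` be the largest direction with `j_{ν*} ≠ 0` and `j′ = j − e_{ν*}`:
the plaquette `p` at `x_{j′} − e_μ` in the `(μ,ν*)` plane has its two `ν*`-sides on the comb (both lead into offsets whose largest active direction is `ν*`), so `P_{U^{ax}}(p) = U^{ax}(b′)·
U^{ax}(b)^*` with `b′` the bond into `x_{j′}` along `μ`; since `P_{U^{ax}} = gP_Ug^*` has `‖P_{U^{ax}} − 1‖ = ‖P_U − 1‖ ≤ ε`, `‖U^{ax}(b) − 1‖ ≤ ‖U^{ax}(b′) − 1‖ + ε`; (iii) induction on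
`Σ_{ν>μ} j_ν` (decreasing by one, reaching a comb bond at `0`).
RESULTS: §1 def `blockAxialGauge U` (`g`), `blockAxialGauge_site`, `blockAxialGauge_mem_unitaryGroup`, def `lowerOff j μ = j − e_μ`, `site_lowerOff_add_unitVec`, `kingCombAxis_eq_of_above_zero`,
`kingCombParent_eq_lowerOff`, ★★ **`axialGauge_treeBond_eq_one`** (comb bonds are flat in the axial gauge), ★ `axialGauge_bond_eq` (`U^{ax}` on the bond into `x_j` along `μ`); §2 def `upperActive j μ`,
`upperActive_spec`, ★★ `kingPlaq_axial_attached` (THE ATTACHED PLAQUETTE IDENTITY `P_{U^{ax}}(p) = U^{ax}(b′)U^{ax}(b)^*`), `norm_kingPlaq_axial_sub_one` (`= ‖P_U − 1‖`-bound), ★ `norm_sub_one_le_of_plaq`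
(one step: `‖B − 1‖ ≤ ‖A − 1‖ + ‖P − 1‖` for `P = AB^*`); §3 ★★★ **`norm_axialGauge_sub_one_le`** (`‖U^{ax}(b) − 1‖ ≤ (Σ_{ν>μ}j_ν)·ε`), ★★★ **`norm_axialGauge_sub_one_le_uniform`** (`≤ d(L−1)·ε` on
every intra-block bond), ★★ `norm_sub_pureGauge_le_of_plaq` (PART Ϥ-h's hypothesis form `‖U(b) − g₀(x)g₀(x′)^*‖ ≤ d(L−1)ε` on intra-block bonds, `g₀ = g^*`).
PRIOR TREE ART (by name): Ϥ-b (`kingComb`, `kingCombAxis_spec`, `kingCombParent_apply`, `treeHol_of_ne_root`, `treeHol_mem_unitaryGroup`, `site_eq_parent_add_unitVec`), Ϥ-f (`offsetOf`, `offsetOf_site`), Ͻ-q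
(`kingPlaq`, `kingPlaq_kingGaugeAct`), Ͱ-a (`kingGaugeAct`), Ͱ-d (`l2_opNorm_of_mem_unitaryGroup_le`), `King1986.Torus` (`site`, `blockOf`, `blockOf_site`), Mathlib (`Matrix.l2_opNorm_conjTranspose`,
`Finset.max'`).  Dedup (rg at filing): basename 0 files; needles `blockAxialGauge|lowerOff|upperActive|norm_axialGauge_sub_one_le` 0 files (`Federbush1986.CombGaugeObservation` = the same device on
`ℤ^d` boxes with group-valued bonds, different carrier — cited).  presearch: «axial gauge small plaquettes imply small links lattice» — [Federbush1987PhaseCellIII] §5.3, [Balaban1985Averaging]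
§1 (small-field gauges); the quantitative statement here is elementary.  Locators: [Balaban1985BackgroundPropagators] (3.35)–(3.37) p.396–397, (3.19) p.393; [Balaban1984PropagatorsI] (1.7) p.18;
[King1986] (2.12) p.653; [Federbush1987PhaseCellIII] §5.3 p.303.  0 `sorry`.
-/

noncomputable section
open scoped BigOperators ComplexConjugate Matrix.Norms.L2Operator
open Finset Matrix

namespace Summit.QuantumFields.YangMills.BalabanUVNodes.N15KingModelRung.CovariantBlock

open Literature.MathematicalPhysics.QuantumFieldTheory.Balaban1983to89.B5Prop11Plancherel (Tor fine unitVec)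
open Literature.MathematicalPhysics.QuantumFieldTheory.King1986.Torus (site blockEquiv blockEquiv_apply blockOf blockOf_site)
open Summit.QuantumFields.YangMills.BalabanUVNodes.N15KingModelRung.Covariant (kingGaugeAct l2_opNorm_of_mem_unitaryGroup_le)
open Summit.QuantumFields.YangMills.BalabanUVNodes.N15KingModelRung.Cover (kingPlaq kingPlaq_kingGaugeAct)

variable {d : ℕ} {L : ℕ} [NeZero L] (M : Fin (d + 1) → ℕ) [hM : ∀ μ, NeZero (M μ)]
variable {𝕜 : Type*} [RCLike 𝕜] {n : Type*} [Fintype n] [DecidableEq n]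

/-! ## §1 The block axial gauge; comb bonds are flat -/

/-- THE BLOCK AXIAL GAUGE: `g(x) = U(Γ_{y,x})`, the transport from `x` to the corner of its block along the comb (PART Ϥ-b `treeHol`), as a gauge transformation of the fine torus.
[cite: Federbush1987PhaseCellIII, §5.3 p.303; Balaban1984PropagatorsI, (1.7) p.18] -/
def blockAxialGauge (U : Tor (fine L M) × Fin (d + 1) → Matrix n n 𝕜) (x : Tor (fine L M)) : Matrix n n 𝕜 :=
  treeHol M (kingComb d L) U (blockOf L M x) (offsetOf L M x)

/-- `g(site y j) = U(Γ_{y,x_j})`. [folklore] -/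
theorem blockAxialGauge_site (U : Tor (fine L M) × Fin (d + 1) → Matrix n n 𝕜) (y : Tor M) (j : Fin (d + 1) → Fin L) :
    blockAxialGauge M U (site L M y j) = treeHol M (kingComb d L) U y j := by
  rw [blockAxialGauge, blockOf_site, offsetOf_site]

/-- The axial gauge is unitary-valued for a unitary link field. [folklore] -/
theorem blockAxialGauge_mem_unitaryGroup {U : Tor (fine L M) × Fin (d + 1) → Matrix n n 𝕜} (hU : ∀ bd, U bd ∈ Matrix.unitaryGroup n 𝕜) (x : Tor (fine L M)) :
    blockAxialGauge M U x ∈ Matrix.unitaryGroup n 𝕜 :=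
  treeHol_mem_unitaryGroup _ M hU _ _

/-- `j − e_μ` (the coordinate `μ` lowered by one; meaningful for `j_μ ≠ 0`). [folklore] -/
def lowerOff (j : Fin (d + 1) → Fin L) (μ : Fin (d + 1)) : Fin (d + 1) → Fin L := Function.update j μ ⟨(j μ : ℕ) - 1, by omega⟩

omit [NeZero L] in
/-- Coordinates of `j − e_μ`. [folklore] -/
theorem lowerOff_apply [NeZero L] (j : Fin (d + 1) → Fin L) (μ ν : Fin (d + 1)) : ((lowerOff j μ ν : ℕ)) = (j ν : ℕ) - (if ν = μ then 1 else 0) := by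
  unfold lowerOff
  by_cases h : ν = μ
  · subst h; rw [Function.update_self, if_pos rfl]
  · rw [Function.update_of_ne h, if_neg h, Nat.sub_zero]

omit hM in
/-- `site y (j − e_μ) + e_μ = site y j` when `j_μ ≠ 0`. [folklore] -/
theorem site_lowerOff_add_unitVec (y : Tor M) {j : Fin (d + 1) → Fin L} {μ : Fin (d + 1)} (hμ : j μ ≠ 0) :
    site L M y (lowerOff j μ) + unitVec (fine L M) μ = site L M y j := by
  have hpos : 1 ≤ (j μ : ℕ) := Nat.one_le_iff_ne_zero.mpr fun h => hμ (Fin.ext h)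
  funext ν
  simp only [site, Pi.add_apply, unitVec, lowerOff_apply]
  by_cases hν : ν = μ
  · subst hν; rw [if_pos rfl, Pi.single_eq_same]; push_cast [Nat.cast_sub hpos]; ring
  · rw [if_neg hν, Nat.sub_zero, Pi.single_eq_of_ne hν, add_zero]

omit [NeZero L] in
/-- THE COMB AXIS IS THE LARGEST ACTIVE DIRECTION: `j_μ ≠ 0` and `j_ν = 0` for all `ν > μ` force `axis j = μ`. [cite: Balaban1984PropagatorsI, (1.7) p.18] -/
theorem kingCombAxis_eq_of_above_zero [NeZero L] {j : Fin (d + 1) → Fin L} {μ : Fin (d + 1)} (hμ : j μ ≠ 0) (habove : ∀ ν, μ < ν → j ν = 0) : kingCombAxis d j = μ := by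
  have hj : j ≠ 0 := fun h => hμ (by rw [h]; rfl)
  obtain ⟨hact, hmax⟩ := kingCombAxis_spec hj
  rcases lt_trichotomy (kingCombAxis d j) μ with h | h | h
  · exact absurd (hmax μ h) hμ
  · exact h
  · exact absurd (habove _ h) hact

omit [NeZero L] in
/-- The comb parent lowers the axis coordinate: `parent j = j − e_{axis j}` (`j ≠ 0`). [cite: Balaban1984PropagatorsI, (1.7) p.18] -/
theorem kingCombParent_eq_lowerOff [NeZero L] {j : Fin (d + 1) → Fin L} (hj : j ≠ 0) : kingCombParent d j = lowerOff j (kingCombAxis d j) := by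
  funext ν; apply Fin.ext; rw [kingCombParent_apply hj, lowerOff_apply]

/-- ★★ **COMB BONDS ARE FLAT IN THE AXIAL GAUGE**: for `j ≠ 0`, `U^{ax}(site y (parent j), axis j) = 1`. [cite: Federbush1987PhaseCellIII, §5.3 p.303; Balaban1984PropagatorsI, (1.7) p.18] -/
theorem axialGauge_treeBond_eq_one {U : Tor (fine L M) × Fin (d + 1) → Matrix n n 𝕜} (hU : ∀ bd, U bd ∈ Matrix.unitaryGroup n 𝕜) (y : Tor M) {j : Fin (d + 1) → Fin L} (hj : j ≠ 0) :
    kingGaugeAct (fine L M) (blockAxialGauge M U) U (site L M y (kingCombParent d j), kingCombAxis d j) = 1 := by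
  have hj' : j ≠ (kingComb d L).root := by simpa using hj
  unfold kingGaugeAct
  simp only
  rw [← kingComb_parent, ← kingComb_axis, ← site_eq_parent_add_unitVec (kingComb d L) M y hj', blockAxialGauge_site, blockAxialGauge_site, ← treeHol_of_ne_root (kingComb d L) M U y hj']
  have := Matrix.mem_unitaryGroup_iff.mp (treeHol_mem_unitaryGroup (kingComb d L) M hU y j)
  simpa only [star_eq_conjTranspose] using this

/-- ★ THE AXIAL LINK INTO `x_j` ALONG `μ` (`j_μ ≠ 0`): `U^{ax}(x_j − e_μ, μ) = U(Γ_{j−e_μ})·U(x_j − e_μ, μ)·U(Γ_j)^*`. [cite: Federbush1987PhaseCellIII, §5.3 p.303] -/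
theorem axialGauge_bond_eq (U : Tor (fine L M) × Fin (d + 1) → Matrix n n 𝕜) (y : Tor M) {j : Fin (d + 1) → Fin L} {μ : Fin (d + 1)} (hμ : j μ ≠ 0) :
    kingGaugeAct (fine L M) (blockAxialGauge M U) U (site L M y (lowerOff j μ), μ)
      = treeHol M (kingComb d L) U y (lowerOff j μ) * U (site L M y (lowerOff j μ), μ) * (treeHol M (kingComb d L) U y j)ᴴ := by
  unfold kingGaugeAct
  simp only
  rw [site_lowerOff_add_unitVec M y hμ, blockAxialGauge_site, blockAxialGauge_site]

/-! ## §2 The attached plaquette of a non-comb bond -/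

/-- THE UPPER ACTIVE DIRECTION of `(j, μ)`: the largest `ν > μ` with `j_ν ≠ 0` (when one exists; else `μ`). [cite: Federbush1987PhaseCellIII, §5.3 p.303] -/
def upperActive (j : Fin (d + 1) → Fin L) (μ : Fin (d + 1)) : Fin (d + 1) :=
  if h : (univ.filter fun ν => μ < ν ∧ j ν ≠ 0).Nonempty then (univ.filter fun ν => μ < ν ∧ j ν ≠ 0).max' h else μ

omit [NeZero L] in
/-- In the non-comb case (`∃ ν > μ, j_ν ≠ 0`): `ν* > μ`, `j_{ν*} ≠ 0`, and `j_ν = 0` for all `ν > ν*`. [cite: Federbush1987PhaseCellIII, §5.3 p.303] -/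
theorem upperActive_spec [NeZero L] {j : Fin (d + 1) → Fin L} {μ : Fin (d + 1)} (h : (univ.filter fun ν => μ < ν ∧ j ν ≠ 0).Nonempty) :
    μ < upperActive j μ ∧ j (upperActive j μ) ≠ 0 ∧ ∀ ν, upperActive j μ < ν → j ν = 0 := by
  have hax : upperActive j μ = (univ.filter fun ν => μ < ν ∧ j ν ≠ 0).max' h := by simp [upperActive, h]
  have hmem := Finset.max'_mem _ h
  rw [← hax] at hmem
  simp only [Finset.mem_filter, Finset.mem_univ, true_and] at hmem
  refine ⟨hmem.1, hmem.2, fun ν hν => ?_⟩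
  by_contra hne
  have hνmem : ν ∈ univ.filter fun ν => μ < ν ∧ j ν ≠ 0 := by simp [lt_trans hmem.1 hν, hne]
  have := Finset.le_max' _ ν hνmem
  rw [← hax] at this
  exact absurd hν (not_lt.mpr this)

omit [NeZero L] in
/-- Lowering a coordinate other than `μ` keeps `j_μ`. [folklore] -/
theorem lowerOff_apply_of_ne [NeZero L] (j : Fin (d + 1) → Fin L) {μ ν : Fin (d + 1)} (h : μ ≠ ν) : lowerOff j ν μ = j μ := by
  unfold lowerOff; rw [Function.update_of_ne h]

omit [NeZero L] in
/-- Lowerings in different directions commute. [folklore] -/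
theorem lowerOff_comm [NeZero L] (j : Fin (d + 1) → Fin L) {μ ν : Fin (d + 1)} (h : μ ≠ ν) : lowerOff (lowerOff j μ) ν = lowerOff (lowerOff j ν) μ := by
  funext κ; apply Fin.ext
  simp only [lowerOff_apply]
  by_cases h1 : κ = μ <;> by_cases h2 : κ = ν
  · exact absurd (h1.symm.trans h2) h
  · subst h1; simp [h2]
  · subst h2; simp [h1]
  · simp [h1, h2]

/-- ★★ **THE ATTACHED PLAQUETTE IDENTITY**: for an intra-block bond into `x_j` along `μ` (`j_μ ≠ 0`) that is not a comb bond, with `ν* = upperActive j μ` and `j′ = j − e_{ν*}`, the `(μ,ν*)`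
plaquette at `x_{j′} − e_μ` in the axial gauge reads `P_{U^{ax}} = U^{ax}(bond into x_{j′} along μ)·U^{ax}(bond into x_j along μ)^*` — its two `ν*`-sides are comb bonds.
[cite: Federbush1987PhaseCellIII, §5.3 p.303; King1986, (2.12) p.653] -/
theorem kingPlaq_axial_attached {U : Tor (fine L M) × Fin (d + 1) → Matrix n n 𝕜} (hU : ∀ bd, U bd ∈ Matrix.unitaryGroup n 𝕜) (y : Tor M) {j : Fin (d + 1) → Fin L} {μ : Fin (d + 1)}
    (hμ : j μ ≠ 0) (h : (univ.filter fun ν => μ < ν ∧ j ν ≠ 0).Nonempty) :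
    kingPlaq (fine L M) (kingGaugeAct (fine L M) (blockAxialGauge M U) U) (site L M y (lowerOff (lowerOff j (upperActive j μ)) μ)) μ (upperActive j μ)
      = kingGaugeAct (fine L M) (blockAxialGauge M U) U (site L M y (lowerOff (lowerOff j (upperActive j μ)) μ), μ)
          * (kingGaugeAct (fine L M) (blockAxialGauge M U) U (site L M y (lowerOff j μ), μ))ᴴ := by
  obtain ⟨hlt, hact, habove⟩ := upperActive_spec h
  set ν := upperActive j μ with hν
  have hμν : μ ≠ ν := ne_of_lt hlt
  set j' := lowerOff j ν with hj'
  -- the four corners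
  have hj'μ : j' μ ≠ 0 := by rw [hj', lowerOff_apply_of_ne j hμν]; exact hμ
  have hc1 : site L M y (lowerOff j' μ) + unitVec (fine L M) μ = site L M y j' := site_lowerOff_add_unitVec M y hj'μ
  have hlow : lowerOff j μ ν ≠ 0 := by rw [lowerOff_apply_of_ne j (Ne.symm hμν)]; exact hact
  have hc2 : site L M y (lowerOff j' μ) + unitVec (fine L M) ν = site L M y (lowerOff j μ) := by
    rw [hj', lowerOff_comm j (Ne.symm hμν), site_lowerOff_add_unitVec M y hlow]
  -- the two ν-sides are comb bonds: into `j` (axis ν, parent j') and into `lowerOff j μ` (axis ν, parent lowerOff j' μ)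
  have hjne : j ≠ 0 := fun h0 => hμ (by rw [h0]; rfl)
  have haxj : kingCombAxis d j = ν := kingCombAxis_eq_of_above_zero hact habove
  have hparj : kingCombParent d j = j' := by rw [kingCombParent_eq_lowerOff hjne, haxj]
  have hlne : lowerOff j μ ≠ 0 := fun h0 => hlow (by rw [h0]; rfl)
  have haxl : kingCombAxis d (lowerOff j μ) = ν :=
    kingCombAxis_eq_of_above_zero hlow fun κ hκ => by
      apply Fin.ext; rw [lowerOff_apply, habove κ hκ, if_neg (ne_of_gt (lt_trans hlt hκ))]; rfl
  have hparl : kingCombParent d (lowerOff j μ) = lowerOff j' μ := by rw [kingCombParent_eq_lowerOff hlne, haxl, hj', lowerOff_comm j (Ne.symm hμν)]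
  have hT1 : kingGaugeAct (fine L M) (blockAxialGauge M U) U (site L M y j', ν) = 1 := by
    have := axialGauge_treeBond_eq_one M hU y hjne; rwa [hparj, haxj] at this
  have hT2 : kingGaugeAct (fine L M) (blockAxialGauge M U) U (site L M y (lowerOff j' μ), ν) = 1 := by
    have := axialGauge_treeBond_eq_one M hU y hlne; rwa [hparl, haxl] at this
  rw [kingPlaq, hc1, hc2, hT1, hT2, Matrix.mul_one, Matrix.conjTranspose_one, Matrix.mul_one]

omit hM in
/-- Conjugating a plaquette by a unitary gauge does not change its distance to `1`: `‖gPg^* − 1‖ ≤ ‖P − 1‖`. [folklore] -/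
theorem norm_conj_sub_one_le {g P : Matrix n n 𝕜} (hg : g ∈ Matrix.unitaryGroup n 𝕜) : ‖g * P * gᴴ - 1‖ ≤ ‖P - 1‖ := by
  have hgg : g * gᴴ = 1 := by simpa only [star_eq_conjTranspose] using Matrix.mem_unitaryGroup_iff.mp hg
  have h1 : g * P * gᴴ - 1 = g * (P - 1) * gᴴ := by rw [Matrix.mul_sub, Matrix.sub_mul, Matrix.mul_one, hgg]
  rw [h1]
  have hgs : gᴴ ∈ Matrix.unitaryGroup n 𝕜 := by simpa only [star_eq_conjTranspose] using Unitary.star_mem hg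
  calc ‖g * (P - 1) * gᴴ‖ ≤ ‖g‖ * ‖P - 1‖ * ‖gᴴ‖ := (norm_mul_le _ _).trans (mul_le_mul_of_nonneg_right (norm_mul_le _ _) (norm_nonneg _))
    _ ≤ 1 * ‖P - 1‖ * 1 := by gcongr <;> exact l2_opNorm_of_mem_unitaryGroup_le ‹_›
    _ = ‖P - 1‖ := by ring

omit hM in
/-- ★ ONE STEP DOWN THE COMB: if `P = A·B^*` with `A`, `P` unitary then `‖B − 1‖ ≤ ‖A − 1‖ + ‖P − 1‖` (`B = P^*A`). [folklore] -/
theorem norm_sub_one_le_of_plaq {A B P : Matrix n n 𝕜} (hB : B ∈ Matrix.unitaryGroup n 𝕜) (hP : P ∈ Matrix.unitaryGroup n 𝕜) (h : P = A * Bᴴ) :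
    ‖B - 1‖ ≤ ‖A - 1‖ + ‖P - 1‖ := by
  have hBB : Bᴴ * B = 1 := by simpa only [star_eq_conjTranspose] using Matrix.mem_unitaryGroup_iff'.mp hB
  have hPs : Pᴴ ∈ Matrix.unitaryGroup n 𝕜 := by simpa only [star_eq_conjTranspose] using Unitary.star_mem hP
  have hBeq : B = Pᴴ * A := by
    rw [h, Matrix.conjTranspose_mul, Matrix.conjTranspose_conjTranspose, Matrix.mul_assoc]
    have hAA : Aᴴ * A = 1 := by
      -- `A = P B` is unitary
      have hA : A = P * B := by rw [h, Matrix.mul_assoc, hBB, Matrix.mul_one]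
      rw [hA, Matrix.conjTranspose_mul, Matrix.mul_assoc, ← Matrix.mul_assoc Pᴴ, show Pᴴ * P = 1 by simpa only [star_eq_conjTranspose] using Matrix.mem_unitaryGroup_iff'.mp hP,
        Matrix.one_mul, hBB]
    rw [hAA, Matrix.mul_one]
  have hsplit : B - 1 = Pᴴ * (A - 1) + (Pᴴ - 1) := by rw [hBeq, Matrix.mul_sub, Matrix.mul_one]; abel
  rw [hsplit]
  calc ‖Pᴴ * (A - 1) + (Pᴴ - 1)‖ ≤ ‖Pᴴ * (A - 1)‖ + ‖Pᴴ - 1‖ := norm_add_le _ _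
    _ ≤ ‖Pᴴ‖ * ‖A - 1‖ + ‖(P - 1)ᴴ‖ := by rw [Matrix.conjTranspose_sub, Matrix.conjTranspose_one]; exact add_le_add (norm_mul_le _ _) le_rfl
    _ ≤ 1 * ‖A - 1‖ + ‖P - 1‖ := by rw [Matrix.l2_opNorm_conjTranspose (P - 1)]; gcongr; exact l2_opNorm_of_mem_unitaryGroup_le hPs
    _ = ‖A - 1‖ + ‖P - 1‖ := by ring

/-! ## §3 Small curvature on the block ⟹ small axial links -/

omit [NeZero L] in
/-- The number of comb steps above `μ`: `Σ_{ν>μ} j_ν`; lowering the upper active direction decreases it by one. [folklore] -/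
theorem sum_above_lowerOff [NeZero L] {j : Fin (d + 1) → Fin L} {μ : Fin (d + 1)} (h : (univ.filter fun ν => μ < ν ∧ j ν ≠ 0).Nonempty) :
    (∑ ν ∈ univ.filter (fun ν => μ < ν), (lowerOff j (upperActive j μ) ν : ℕ)) + 1 = ∑ ν ∈ univ.filter (fun ν => μ < ν), (j ν : ℕ) := by
  obtain ⟨hlt, hact, -⟩ := upperActive_spec h
  have hmem : upperActive j μ ∈ univ.filter (fun ν => μ < ν) := by simp [hlt]
  have hpos : 1 ≤ (j (upperActive j μ) : ℕ) := Nat.one_le_iff_ne_zero.mpr fun h0 => hact (Fin.ext h0)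
  rw [← Finset.add_sum_erase _ _ hmem, ← Finset.add_sum_erase _ (fun ν => (j ν : ℕ)) hmem]
  have hrest : ∑ ν ∈ (univ.filter (fun ν => μ < ν)).erase (upperActive j μ), (lowerOff j (upperActive j μ) ν : ℕ)
      = ∑ ν ∈ (univ.filter (fun ν => μ < ν)).erase (upperActive j μ), (j ν : ℕ) :=
    Finset.sum_congr rfl fun ν hν => by rw [lowerOff_apply, if_neg (Finset.ne_of_mem_erase hν), Nat.sub_zero]
  rw [hrest, lowerOff_apply, if_pos rfl]
  omega

/-- ★★★ **THE LATTICE POINCARÉ LEMMA IN THE BLOCK AXIAL GAUGE**: if every plaquette based in block `y` satisfies `‖P_U(site y k; κ, ρ) − 1‖ ≤ ε`, then for every offset `j` and direction `μ`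
with `j_μ ≠ 0` (an intra-block bond into `x_j` along `μ`): `‖U^{ax}(x_j − e_μ, μ) − 1‖ ≤ (Σ_{ν>μ} j_ν)·ε` — the number of attached plaquettes down to the comb times `ε`.
[cite: Federbush1987PhaseCellIII, §5.3 p.303; Balaban1985BackgroundPropagators, (3.35)–(3.37) p.396–397; King1986, (2.12) p.653] -/
theorem norm_axialGauge_sub_one_le {U : Tor (fine L M) × Fin (d + 1) → Matrix n n 𝕜} (hU : ∀ bd, U bd ∈ Matrix.unitaryGroup n 𝕜) (y : Tor M) {ε : ℝ}
    (hε : ∀ (k : Fin (d + 1) → Fin L) (κ ρ : Fin (d + 1)), ‖kingPlaq (fine L M) U (site L M y k) κ ρ - 1‖ ≤ ε) :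
    ∀ (j : Fin (d + 1) → Fin L) (μ : Fin (d + 1)), j μ ≠ 0 →
      ‖kingGaugeAct (fine L M) (blockAxialGauge M U) U (site L M y (lowerOff j μ), μ) - 1‖ ≤ (∑ ν ∈ univ.filter (fun ν => μ < ν), (j ν : ℕ) : ℕ) * ε := by
  have hε0 : 0 ≤ ε := (norm_nonneg _).trans (hε 0 0 0)
  have hg : ∀ x, blockAxialGauge M U x ∈ Matrix.unitaryGroup n 𝕜 := blockAxialGauge_mem_unitaryGroup M hU
  have hUax : ∀ bd, kingGaugeAct (fine L M) (blockAxialGauge M U) U bd ∈ Matrix.unitaryGroup n 𝕜 :=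
    Summit.QuantumFields.YangMills.BalabanUVNodes.N15KingModelRung.Covariant.kingGaugeAct_mem_unitaryGroup (fine L M) hg hU
  suffices hmain : ∀ (S : ℕ) (j : Fin (d + 1) → Fin L) (μ : Fin (d + 1)), j μ ≠ 0 → (∑ ν ∈ univ.filter (fun ν => μ < ν), (j ν : ℕ)) = S →
      ‖kingGaugeAct (fine L M) (blockAxialGauge M U) U (site L M y (lowerOff j μ), μ) - 1‖ ≤ (S : ℝ) * ε from
    fun j μ hμ => hmain _ j μ hμ rfl
  intro S
  induction S with
  | zero =>
    intro j μ hμ hS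
    -- all coordinates above μ vanish: a comb bond
    have habove : ∀ ν, μ < ν → j ν = 0 := by
      intro ν hν
      have := (Finset.sum_eq_zero_iff.mp hS) ν (by simp [hν])
      exact Fin.ext this
    have hjne : j ≠ 0 := fun h0 => hμ (by rw [h0]; rfl)
    have hax : kingCombAxis d j = μ := kingCombAxis_eq_of_above_zero hμ habove
    have hpar : kingCombParent d j = lowerOff j μ := by rw [kingCombParent_eq_lowerOff hjne, hax]
    have := axialGauge_treeBond_eq_one M hU y hjne
    rw [hpar, hax] at this
    rw [this, sub_self, norm_zero]; simp
  | succ S ih =>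
    intro j μ hμ hS
    -- a non-comb bond: the attached plaquette
    have hne : (univ.filter fun ν => μ < ν ∧ j ν ≠ 0).Nonempty := by
      by_contra h0
      rw [Finset.not_nonempty_iff_eq_empty, Finset.filter_eq_empty_iff] at h0
      have : (∑ ν ∈ univ.filter (fun ν => μ < ν), (j ν : ℕ)) = 0 :=
        Finset.sum_eq_zero fun ν hν => by
          have hν := (Finset.mem_filter.mp hν).2
          have := h0 (Finset.mem_univ ν)
          push Not at this
          exact congrArg Fin.val (this hν)
      omega
    obtain ⟨hlt, hact, -⟩ := upperActive_spec hne
    set j' := lowerOff j (upperActive j μ) with hj'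
    have hj'μ : j' μ ≠ 0 := by rw [hj', lowerOff_apply_of_ne j (ne_of_lt hlt)]; exact hμ
    have hS' : (∑ ν ∈ univ.filter (fun ν => μ < ν), (j' ν : ℕ)) = S := by
      have := sum_above_lowerOff hne
      rw [← hj'] at this
      omega
    have hA := ih j' μ hj'μ hS'
    have hP := hε (lowerOff j' μ) μ (upperActive j μ)
    have hPax := kingPlaq_axial_attached M hU y hμ hne
    rw [kingPlaq_kingGaugeAct (fine L M) hg U] at hPax
    have hstep := norm_sub_one_le_of_plaq (hUax _) (Submonoid.mul_mem _ (Submonoid.mul_mem _ (hg _) ?_) ?_) hPax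
    · calc ‖kingGaugeAct (fine L M) (blockAxialGauge M U) U (site L M y (lowerOff j μ), μ) - 1‖
          ≤ ‖kingGaugeAct (fine L M) (blockAxialGauge M U) U (site L M y (lowerOff j' μ), μ) - 1‖
              + ‖blockAxialGauge M U (site L M y (lowerOff j' μ)) * kingPlaq (fine L M) U (site L M y (lowerOff j' μ)) μ (upperActive j μ) * (blockAxialGauge M U (site L M y (lowerOff j' μ)))ᴴ - 1‖ := hstep
        _ ≤ (S : ℝ) * ε + ε := add_le_add hA ((norm_conj_sub_one_le (hg _)).trans hP)
        _ = ((S + 1 : ℕ) : ℝ) * ε := by push_cast; ring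
    · -- the plaquette is unitary
      unfold kingPlaq
      refine Submonoid.mul_mem _ (Submonoid.mul_mem _ (Submonoid.mul_mem _ (hU _) (hU _)) ?_) ?_ <;>
        simpa only [star_eq_conjTranspose] using Unitary.star_mem (hU _)
    · simpa only [star_eq_conjTranspose] using Unitary.star_mem (hg _)

/-- ★★★ **UNIFORMLY: EVERY INTRA-BLOCK BOND IS WITHIN `d(L−1)ε` OF THE IDENTITY IN THE AXIAL GAUGE** (`Σ_{ν>μ}j_ν ≤ d(L−1)`: at most `d` directions above `μ`, each coordinate `≤ L−1`).
[cite: Federbush1987PhaseCellIII, §5.3 p.303; Balaban1985BackgroundPropagators, (3.35)–(3.37) p.396–397] -/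
theorem norm_axialGauge_sub_one_le_uniform {U : Tor (fine L M) × Fin (d + 1) → Matrix n n 𝕜} (hU : ∀ bd, U bd ∈ Matrix.unitaryGroup n 𝕜) (y : Tor M) {ε : ℝ}
    (hε : ∀ (k : Fin (d + 1) → Fin L) (κ ρ : Fin (d + 1)), ‖kingPlaq (fine L M) U (site L M y k) κ ρ - 1‖ ≤ ε) (j : Fin (d + 1) → Fin L) (μ : Fin (d + 1)) (hμ : j μ ≠ 0) :
    ‖kingGaugeAct (fine L M) (blockAxialGauge M U) U (site L M y (lowerOff j μ), μ) - 1‖ ≤ (d * (L - 1) : ℕ) * ε := by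
  have hε0 : 0 ≤ ε := (norm_nonneg _).trans (hε 0 0 0)
  refine (norm_axialGauge_sub_one_le M hU y hε j μ hμ).trans (mul_le_mul_of_nonneg_right ?_ hε0)
  have hcard : (univ.filter (fun ν : Fin (d + 1) => μ < ν)).card ≤ d := by
    have h1 : (univ.filter (fun ν : Fin (d + 1) => μ < ν)) ⊆ univ.erase μ := fun ν hν => by
      simp only [Finset.mem_filter, Finset.mem_univ, true_and] at hν; simp [ne_of_gt hν]
    have := Finset.card_le_card h1
    rw [Finset.card_erase_of_mem (Finset.mem_univ μ), Finset.card_univ, Fintype.card_fin] at this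
    omega
  have hsum : ∑ ν ∈ univ.filter (fun ν => μ < ν), (j ν : ℕ) ≤ (univ.filter (fun ν : Fin (d + 1) => μ < ν)).card * (L - 1) := by
    rw [← smul_eq_mul, ← Finset.sum_const]
    exact Finset.sum_le_sum fun ν _ => by have := (j ν).isLt; omega
  exact_mod_cast hsum.trans (Nat.mul_le_mul_right _ hcard)

/-- ★★ **PART Ϥ-h's HYPOTHESIS FORM ON INTRA-BLOCK BONDS**: with `g₀ = g^*`, `‖U(b) − g₀(x)g₀(x′)^*‖ ≤ ‖U^{ax}(b) − 1‖ ≤ d(L−1)ε` for every intra-block bond `b = (x, μ)`, `x′ = x + e_μ`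
(`U − g^*g′ = g^*(gUg′^* − 1)g′`). [cite: Balaban1985BackgroundPropagators, (3.37) p.397] -/
theorem norm_sub_pureGauge_le_of_plaq {U : Tor (fine L M) × Fin (d + 1) → Matrix n n 𝕜} (hU : ∀ bd, U bd ∈ Matrix.unitaryGroup n 𝕜) (y : Tor M) {ε : ℝ}
    (hε : ∀ (k : Fin (d + 1) → Fin L) (κ ρ : Fin (d + 1)), ‖kingPlaq (fine L M) U (site L M y k) κ ρ - 1‖ ≤ ε) (j : Fin (d + 1) → Fin L) (μ : Fin (d + 1)) (hμ : j μ ≠ 0) :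
    ‖U (site L M y (lowerOff j μ), μ) - kingGaugeAct (fine L M) (fun x => (blockAxialGauge M U x)ᴴ) (fun _ => (1 : Matrix n n 𝕜)) (site L M y (lowerOff j μ), μ)‖ ≤ (d * (L - 1) : ℕ) * ε := by
  refine le_trans ?_ (norm_axialGauge_sub_one_le_uniform M hU y hε j μ hμ)
  set x := site L M y (lowerOff j μ) with hx
  set g := blockAxialGauge M U with hgdef
  have hg : ∀ z, g z ∈ Matrix.unitaryGroup n 𝕜 := blockAxialGauge_mem_unitaryGroup M hU
  have hgg : ∀ z, (g z)ᴴ * g z = 1 := fun z => by simpa only [star_eq_conjTranspose] using Matrix.mem_unitaryGroup_iff'.mp (hg z)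
  have hgg' : ∀ z, g z * (g z)ᴴ = 1 := fun z => by simpa only [star_eq_conjTranspose] using Matrix.mem_unitaryGroup_iff.mp (hg z)
  -- `U − g^*g′ = g^*·(gUg′^* − 1)·g′`
  have hid : U (x, μ) - kingGaugeAct (fine L M) (fun z => (g z)ᴴ) (fun _ => (1 : Matrix n n 𝕜)) (x, μ)
      = (g x)ᴴ * (kingGaugeAct (fine L M) g U (x, μ) - 1) * g (x + unitVec (fine L M) μ) := by
    simp only [kingGaugeAct, Matrix.mul_one, Matrix.conjTranspose_conjTranspose, Matrix.mul_sub, Matrix.sub_mul, Matrix.mul_one]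
    rw [← Matrix.mul_assoc, ← Matrix.mul_assoc, hgg, Matrix.one_mul, Matrix.mul_assoc, hgg, Matrix.mul_one]
  rw [hid]
  have hgs : (g x)ᴴ ∈ Matrix.unitaryGroup n 𝕜 := by simpa only [star_eq_conjTranspose] using Unitary.star_mem (hg x)
  calc ‖(g x)ᴴ * (kingGaugeAct (fine L M) g U (x, μ) - 1) * g (x + unitVec (fine L M) μ)‖
      ≤ ‖(g x)ᴴ‖ * ‖kingGaugeAct (fine L M) g U (x, μ) - 1‖ * ‖g (x + unitVec (fine L M) μ)‖ := (norm_mul_le _ _).trans (mul_le_mul_of_nonneg_right (norm_mul_le _ _) (norm_nonneg _))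
    _ ≤ 1 * ‖kingGaugeAct (fine L M) g U (x, μ) - 1‖ * 1 := by
        gcongr
        all_goals first | exact l2_opNorm_of_mem_unitaryGroup_le hgs | exact l2_opNorm_of_mem_unitaryGroup_le (hg _)
    _ = ‖kingGaugeAct (fine L M) g U (x, μ) - 1‖ := by ring

end Summit.QuantumFields.YangMills.BalabanUVNodes.N15KingModelRung.CovariantBlock

end
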